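import Summits.AnomalousDissipation.AnomalousDissipation.Theorems.BaireTransferDenseLoudDesignerForcesErgodicModelCore

/-!
# Compactness of the V-frame model core `Λ_V = (1 + A)^{1/2} K_c` of an NS phase (tools stub
# `stub_modelCoreCompactVTools` of block N, line `ergodic-budget-selection-closing`, crux `BaireTransfer.DenseLoudDesignerForces`,
# stmt-AnomalousDissipation-1143)

Block N of the line models the Navier–Stokes semiflow `φ` of an NS phase `(K, φ)` (`IsNSPhase ν F K φ`,
`…ErgodicLine.lean`) near a compact core `K_c ⊆ φ_τ(K)` through the V-frame smoothing isomorphism `S = (1 + A)^{-1/2}`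
(`A = Torus.stokesOperatorH (Fin 3)`, the Stokes operator in the energy space `H`; `S` and its square `R = S ∘ S = (1 + A)⁻¹`
are the neighbour tools stub `stub_sqrtResolventTools`, `Literature/Analysis/FluidPDE/StokesTorusSqrtResolvent.lean`).  The
V-frame model core is `Λ_V := S ⁻¹' K_c = (1 + A)^{1/2} K_c`, and the hyperbolic-semiflow-model interface needs it COMPACT in
`H`.  This file proves the registered tools stub `stub_modelCoreCompactVTools` from the LANDED `H²`-frame statement
`stub_modelCoreCompactTools` (`…ErgodicModelCore.lean`: `R ⁻¹' K_c` is compact, `R '' (R ⁻¹' K_c) = K_c`, `K_c ⊆ D(A)`)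
by pure set algebra: since `K_c ⊆ range R` and `S` is injective, `S ⁻¹' K_c = S '' (R ⁻¹' K_c)` is the continuous image of
a compact set, and `S` maps it onto `K_c`.  No new estimate is needed.

References: Constantin–Foias, *Navier–Stokes Equations* (1988) Ch. 4 (`V = D(A^{1/2})`, `D(A) = H ∩ H²`, compactness of
`V ⊂ H`); Robinson–Rodrigo–Sadowski, *The Three-Dimensional Navier–Stokes Equations* (CUP 2016) Thm 1.19, Thm 7.1–7.5.
-/

-- `Summit.<Summit>.<Problem>` is the tree's mandated summit-side namespace (CONVENTIONS §2); for this
-- single-conjunct summit the two coincide, so the duplicate is deliberate.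
set_option linter.dupNamespace false

noncomputable section

open scoped BigOperators Topology ENNReal InnerProductSpace
open Filter Set Function MeasureTheory

namespace Summit.AnomalousDissipation.AnomalousDissipation.Theorems.DenseLoudDesignerForces.Ergodic

open Literature.Analysis.FunctionSpaces Literature.Analysis.FunctionSpaces.Torus
open Literature.Analysis.FluidPDE Literature.Analysis.FluidPDE.Torus
open Summit.AnomalousDissipation.AnomalousDissipation.Theses.BaireTransfer
open Summit.AnomalousDissipation.AnomalousDissipation.Theorems.DenseLoudDesignerForces.Negative

/-- **Tools stub N0h — compactness of the V-frame model core `Λ_V = S ⁻¹' K_c = (1 + A)^{1/2} K_c`** (registered tools stub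
`stub_modelCoreCompactVTools` of block N, crux stmt-AnomalousDissipation-1143, line `ergodic-budget-selection-closing`).
For an NS phase `(K, φ)` at `ν > 0`, a compact `K_c ⊆ φ_τ(K)` (`τ > 0`), an injective `S` with `S ∘ S = R` a two-sided
inverse of `1 + A` (`hR`, `hR'`): `S ⁻¹' K_c = S '' (R ⁻¹' K_c)` (because `K_c ⊆ D(A) = range R`, from `R (v + A v) = v`, and
`S` is injective: `S z = R y = S (S y)` forces `z = S y`), so `Λ_V` is the continuous image of the compact `H²`-frame core
`R ⁻¹' K_c` of `stub_modelCoreCompactTools` — no new estimate is needed — and `S` maps it onto `K_c`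
(`v = R y = S (S y)` with `S y ∈ S ⁻¹' K_c`). [folklore] -/
theorem stub_modelCoreCompactVTools {ν : ℝ} {F : (UnitAddTorus (Fin 3)) → (EuclideanSpace ℝ (Fin 3))} {K : Set Hsp}
    {φ : ℝ → Hsp → Hsp} (hν : 0 < ν) (hK : IsNSPhase ν F K φ) (S R : Hsp →L[ℝ] Hsp) (hSR : S.comp S = R)
    (hS : Function.Injective S)
    (hR : ∀ v : Hsp, ∃ hv : R v ∈ (stokesOperatorH (Fin 3)).domain, R v + stokesOperatorH (Fin 3) ⟨R v, hv⟩ = v)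
    (hR' : ∀ (v : Hsp) (hv : v ∈ (stokesOperatorH (Fin 3)).domain), R (v + stokesOperatorH (Fin 3) ⟨v, hv⟩) = v)
    {Kc : Set Hsp} (hKc : IsCompact Kc) {τ : ℝ} (hτ : 0 < τ) (hsub : Kc ⊆ φ τ '' K) :
    IsCompact (S ⁻¹' Kc) ∧ S '' (S ⁻¹' Kc) = Kc ∧ S '' (R ⁻¹' Kc) = S ⁻¹' Kc := by
  -- the `H²`-frame core `R ⁻¹' K_c` is compact and `R` maps it onto `K_c`
  obtain ⟨hcpt, himg, -⟩ := stub_modelCoreCompactTools hν hK R hR hR' hKc hτ hsub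
  -- `S (S y) = R y`
  have hSS : ∀ y : Hsp, S (S y) = R y := fun y => by rw [← hSR, ContinuousLinearMap.comp_apply]
  -- the key set identity `S '' (R ⁻¹' K_c) = S ⁻¹' K_c`
  have hkey : S '' (R ⁻¹' Kc) = S ⁻¹' Kc := by
    refine Set.Subset.antisymm ?_ fun z hz => ?_
    · rintro _ ⟨y, hy, rfl⟩
      show S (S y) ∈ Kc
      rw [hSS]
      exact hy
    · -- `S z ∈ K_c = R '' (R ⁻¹' K_c)`: `S z = R y = S (S y)`, hence `z = S y`
      have hz' : S z ∈ R '' (R ⁻¹' Kc) := by rw [himg]; exact hz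
      obtain ⟨y, hy, hyz⟩ := hz'
      refine ⟨y, hy, hS ?_⟩
      rw [hSS, hyz]
  refine ⟨?_, ?_, hkey⟩
  · -- compact: continuous image of the compact `R ⁻¹' K_c`
    rw [← hkey]
    exact hcpt.image S.continuous
  · -- `S` maps `S ⁻¹' K_c` onto `K_c`: `v = R y = S (S y)` with `S y ∈ S ⁻¹' K_c`
    refine Set.image_preimage_eq_of_subset fun v hv => ?_
    have hv' : v ∈ R '' (R ⁻¹' Kc) := by rw [himg]; exact hv
    obtain ⟨y, -, rfl⟩ := hv'
    exact ⟨S y, hSS y⟩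

end Summit.AnomalousDissipation.AnomalousDissipation.Theorems.DenseLoudDesignerForces.Ergodic

end
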